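import Summits.Ventures.HodgeRepro.Night3WeilModel
import Summits.Ventures.HodgeRepro.Night3FaceClosure
import Summits.Ventures.HodgeRepro.Night3FaceClosureGSetFull

/-!
# «S4-faces ⟹ S4» in a Weil model: Lemma P discharged inside the kernel

Blind re-derivation cell `pub-hodge-repro`, seat `night-3` (gen 2).  Imports night-3's `Night3WeilModel` (Lemma P's
product closure and cancellation as theorems of a `WeilModel`), `Night3FaceClosure` (`alg_of_faces`, every `m ≥ 1`;
Lemma L = typer-2's `span_pairs_faces_eq_zeroSum`) and `Night3FaceClosureGSetFull` (`alg_of_faces_gset_full`, the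
`(G, c)` model).  Namespace `HodgeRepro.Night3`.

`alg_of_faces` took Lemma P as the hypotheses `hadd` / `hcancel`.  Here they are supplied by `WeilModel.alg_add` /
`WeilModel.alg_cancel`, so the reduction reads: in every Weil model over the multisets of CM types of `F` (`K` infinite,
finitely many embeddings), **if the Weil spaces of the conjugate pairs `{T, T̄}` (Lefschetz (1,1)) and of the census faces
(the route's open input) are algebraic, then the Weil space of EVERY zero-sum corner product is algebraic** — S4 for `F`,
with Lemma L in the kernel (typer-2), the combinatorics in the kernel (night-3 gen 0) and Lemma P's linear algebra in the
kernel (this row), the Hodge theory reduced to the five fields of `WeilModel` (`WeilModel.alg_of_faces`; with the lead's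
generator set `WeilModel.alg_of_rankFourFaces`; on typer's `(G, c)` model `WeilModel.alg_of_faces_gset`).  Nothing here
closes S4: `hface` stays a hypothesis; no sealed file is touched; no Tier-2 item depends on this file.
-/

set_option autoImplicit false

namespace HodgeRepro.Night3

open HodgeRepro.FaceLattice
open scoped Pointwise

universe u

variable {K L : Type*} [Field K] [Field L] [Algebra K L] {ι : Type*}

/-- **«S4-faces ⟹ S4» in a Weil model** (sign vectors, every `m ≥ 1`): for a Weil model `X` over the multisets of CM types
with `m` places, if `W_F(B_{T, T̄})` is algebraic for every `T` (`hpair`, Lefschetz (1,1)) and `W_F(B_{face})` is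
algebraic for every census face (`hface`, S4 on the faces), then `W_F(B_M)` is algebraic for every zero-sum `M`.
Lemma P enters through `WeilModel.alg_add` / `WeilModel.alg_cancel` only. -/
theorem WeilModel.alg_of_faces [Infinite K] [Fintype ι] {m : ℕ} (hm : 0 < m)
    (X : WeilModel.{u} K L ι (Multiset (CMType m)))
    (hpair : ∀ T, X.W (pairMul T) ≤ X.Alg (pairMul T))
    (hface : ∀ Φ p p', p ≠ p' → X.W (faceMul Φ p p') ≤ X.Alg (faceMul Φ p p'))
    (M : Multiset (CMType m)) (hM : IsZeroSum M) : X.W M ≤ X.Alg M :=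
  HodgeRepro.Night3.alg_of_faces hm (fun N => X.W N ≤ X.Alg N)
    (fun M N _ _ => X.alg_add M N) (fun M N _ _ => X.alg_cancel M N) hpair hface M hM

/-- **«S4-faces ⟹ S4» in a Weil model, with the lead's generator set** (LEMMA-L-P-v2.md «Consequence», `m ≥ 3`): the same
conclusion when `W_F(B_{quad})` is algebraic for every zero-sum quadruple without a conjugate pair (which includes the
census faces; gen 0's `alg_of_rankFourFaces`). -/
theorem WeilModel.alg_of_rankFourFaces [Infinite K] [Fintype ι] {m : ℕ} (hm : 3 ≤ m)
    (X : WeilModel.{u} K L ι (Multiset (CMType m)))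
    (hpair : ∀ T, X.W (pairMul T) ≤ X.Alg (pairMul T))
    (hquad : ∀ a b c d, IsZeroSumQuad a b c d → ConjFree a b c d →
      X.W (quadMul a b c d) ≤ X.Alg (quadMul a b c d))
    (M : Multiset (CMType m)) (hM : IsZeroSum M) : X.W M ≤ X.Alg M :=
  HodgeRepro.Night3.alg_of_rankFourFaces hm (fun N => X.W N ≤ X.Alg N)
    (fun M N _ _ => X.alg_add M N) (fun M N _ _ => X.alg_cancel M N) hpair hquad M hM

/-- **«S4-faces ⟹ S4» in a Weil model on the `(G, c)` model**: `G` a finite group with a complex conjugation `c`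
(typer's `IsComplexConj`), `X` a Weil model over the multisets of subsets of `G`; if the Weil spaces of the pairs
`{Φ, c • Φ}` and of the census faces `faceCornersMul c Φ p p'` (`p' ∉ place c p`) are algebraic, then `W_F(B_M)` is
algebraic for every zero-sum multiset `M` of CM types (`IsZeroSumG c M`). -/
theorem WeilModel.alg_of_faces_gset [Infinite K] [Fintype ι] {G : Type*} [Group G] [DecidableEq G] [Fintype G]
    {c : G} (hc : IsComplexConj c) (X : WeilModel.{u} K L ι (Multiset (Finset G)))
    (hpair : ∀ Φ, IsCMType c Φ → X.W {Φ, c • Φ} ≤ X.Alg {Φ, c • Φ})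
    (hface : ∀ Φ p p', IsCMType c Φ → p' ∉ place c p →
      X.W (GSet.faceCornersMul c Φ p p') ≤ X.Alg (GSet.faceCornersMul c Φ p p'))
    (M : Multiset (Finset G)) (hM : GSet.IsZeroSumG c M) : X.W M ≤ X.Alg M :=
  GSet.alg_of_faces_gset_full hc (fun N => X.W N ≤ X.Alg N)
    (fun M N _ _ => X.alg_add M N) (fun M N _ _ => X.alg_cancel M N) hpair hface M hM

end HodgeRepro.Night3
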